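import Summits.ValiantsHypothesis.ValiantsHypothesis.Theorems.TwoProducts.RankThreeWronskianTowerLevels

/-!
# Rank three, part R3c-3 (`TowerKernel3`, R4 + the law): ★★ `rankThreeLinearLaw : RankThreeLinearLaw` (c = 22) and ★★ `twoProductsLinRankThree : TwoProductsLinRankThree`

The two LAW STATEMENTS `RankThreeLinearLaw` / `TwoProductsLinRankThree` (`def … : Prop`, byte-identical to the workfile's rev 1, crit-8 #47 «nothing weakened»;
READING, VERDICT #42 (P2): `t` bounds the sparsity of the three GENERATORS only, `P` is ANY homogeneous polynomial of degree `m`), the proved bridge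
`twoProductsLinRankThree_of_law` (`P := ∏ⱼ(Σᵢ aⱼᵢ Xᵢ) − ∏ⱼ(Σᵢ bⱼᵢ Xᵢ)`; helpers `linForm_isHomogeneous` / `prodLin_isHomogeneous` / `aeval_linForm`), and R4 of
`TowerKernel3`: the degenerate branches `not_isEdgeDir_C` / `aeval_C3` / `aeval_rank1` / `not_isEdgeDir_C_mul_pow`, the counts `card_Eset_omega_le` (≤ 729t⁶),
★ `arc_bound3` (≤ (m+1)(2+729t⁶) edges per arc), `Eset_bound3`, `rankThree_nv_bound` (two charts + 4, via ✓ `nv_le`), `k3_arith`, and the headlines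
★★ `rankThreeLinearLaw` — for all `m, t`, every `w : Fin 3 → ℂ[x,y]` with `≤ t` monomials per generator and every HOMOGENEOUS `P : Poly3` of degree `m`,
`nv (aeval w P) ≤ (m+2)²²·(t+2)²²` — and ★★ `twoProductsLinRankThree`: every `TwoProducts` table `f g : Fin m → ℂ[x,y]` whose `2m` rows lie in the span of three
`t`-sparse `wᵢ` has `nv(∏f − ∏g) ≤ (m+2)²²(t+2)²²` (THE CLASS-(3,·) LAW = K13 side-ladder rung 3-LIN, now THEOREMS-class; F4′ of record: escapes need `dim V ≥ 4`).

Port (val-port-4 g4, desk RULING #498 (A)/#499; critic of record val-idea-crit-8 g4, VERDICT #47 «R3c PORT LICENCE» — «the two headline theorems WITH their `def`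
statements … portable now that they are proved») of val-idea-35 g10's crux workfile `Cruxes/TwoProducts/RankThreeWronskian_val_idea_35_g10.lean` REV 2 @1064d0978540 (sha16 d29beed995ebec39, 2064 l., farm rc 0 / 0 sorry / std axioms):
the two defs (l. 88–109), the bridge block (l. 597–628) and `section TowerKernel3` R4 (l. 1766–1986) — bodies VERBATIM, namespace `…Cruxes.TwoProducts.ValIdea35g10` →
`…Theorems.TwoProducts.RankTwoJacobian`; imports part R3c-2; NOT ported: `RankThreeExplicitBound`, `explicit_le_pow`, `rankThreeLinearLaw_of_explicit`, `PortPlan3`,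
`portPlan3_tail`, `nv_zero` (paper / bookkeeping of the unported sharp bound); lint docstrings added to 5 helpers.
HONEST LABEL: helper/instance theorems for the SIDE ladder «table-rank-ladder» (K13, rung 3-LIN) of crux `stmt-ValiantsHypothesis-5906` (`TwoProducts`):
a class-(3,·) law with a crude constant; NOT γ; `RankThreeExplicitBound` (the sharp `t³ + 9t²(4m+1)`) and `PortPlan3` stay PAPER in the workfile and are NOT
ported; nothing closes 5906 / `PlanarCellBound` / `ResidualLawV25`; 0 distance on the crux; VP ≠ VNP is NOT proved.  `--supports stmt-ValiantsHypothesis-5906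
--as helper`.  Credit: val-idea-35 g10 (crit-8 g4 VERDICT #47 ★★).  No instances, no notation, no named facts. [folklore]
-/

noncomputable section
set_option linter.dupNamespace false

namespace Summit.ValiantsHypothesis.ValiantsHypothesis.Theorems.TwoProducts.RankTwoJacobian

open scoped BigOperators Pointwise Classical
open MvPolynomial

/-- RANK-THREE LINEAR LAW (memo §3 Theorem, coarse form): `Newt P(w₀,w₁,w₂)` has `poly(m,t)` vertices for HOMOGENEOUS `P`
of degree `m`.  READING (VERDICT #42 (P2)): `t` bounds the sparsity of the three GENERATORS `w i` ONLY — `P` is any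
homogeneous polynomial with any number of monomials (this is NOT a sparse-`P` statement); `w 2 = 1`, `w = 0` and
`P(w) = 0` (`nv_zero`) are allowed corners.  (Non-homogeneous `P` of rank 3 = homogeneous rank 4 is the ONSET of record,
memo §4: not claimed.) -/
def RankThreeLinearLaw : Prop :=
  ∃ c : ℕ, ∀ (m t : ℕ) (P : Poly3) (w : Fin 3 → Poly2),
    P.IsHomogeneous m → (∀ i, (w i).support.card ≤ t) →
    nv (MvPolynomial.aeval w P) ≤ (m + 2) ^ c * (t + 2) ^ c

/-- The class of `TwoProducts` instances DECIDED by the law: tables `f, g : Fin m → ℂ[x,y]` all of whose `2m` rows lie in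
the span of three `t`-sparse polynomials `w₀,w₁,w₂` (w.l.o.g. three of the rows).  Bound polynomial in `m` AND `t`. -/
def TwoProductsLinRankThree : Prop :=
  ∃ c : ℕ, ∀ (m t : ℕ) (f g : Fin m → Poly2) (w : Fin 3 → Poly2),
    (∀ j, ∃ a : Fin 3 → ℂ, f j = ∑ i, a i • w i) → (∀ j, ∃ a : Fin 3 → ℂ, g j = ∑ i, a i • w i) →
    (∀ i, (w i).support.card ≤ t) →
    nv (∏ j, f j - ∏ j, g j) ≤ (m + 2) ^ c * (t + 2) ^ c

/-- a linear form `Σ aᵢ Xᵢ` is homogeneous of degree `1`. -/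
theorem linForm_isHomogeneous (a : Fin 3 → ℂ) : (∑ i : Fin 3, C (a i) * X i : Poly3).IsHomogeneous 1 := by
  apply IsHomogeneous.sum
  intro i _
  exact (isHomogeneous_X ℂ i).C_mul (a i)

/-- a product of `m` linear forms is homogeneous of degree `m`. -/
theorem prodLin_isHomogeneous (m : ℕ) (a : Fin m → Fin 3 → ℂ) :
    (∏ j : Fin m, ∑ i : Fin 3, C (a j i) * X i : Poly3).IsHomogeneous m := by
  have h := IsHomogeneous.prod (Finset.univ : Finset (Fin m)) (fun j => (∑ i : Fin 3, C (a j i) * X i : Poly3))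
    (fun _ => 1) (fun j _ => linForm_isHomogeneous (a j))
  simpa using h

/-- evaluating a linear form at `w`: `(Σ aᵢ Xᵢ)(w) = Σ aᵢ • wᵢ`. -/
theorem aeval_linForm (w : Fin 3 → Poly2) (a : Fin 3 → ℂ) :
    aeval w (∑ i : Fin 3, C (a i) * X i : Poly3) = ∑ i, a i • w i := by
  rw [map_sum]
  refine Finset.sum_congr rfl fun i _ => ?_
  rw [map_mul, aeval_C, aeval_X, MvPolynomial.algebraMap_eq, MvPolynomial.smul_eq_C_mul]

/-- `RankThreeLinearLaw → TwoProductsLinRankThree`: with `P := ∏ⱼ(Σᵢ aⱼᵢ Xᵢ) − ∏ⱼ(Σᵢ bⱼᵢ Xᵢ)` (homogeneous of degree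
`m`), `P(w) = ∏ f − ∏ g`. -/
theorem twoProductsLinRankThree_of_law (h : RankThreeLinearLaw) : TwoProductsLinRankThree := by
  obtain ⟨c, hc⟩ := h
  refine ⟨c, fun m t f g w hf hg hw => ?_⟩
  choose a ha using hf
  choose b hb using hg
  have hP : ((∏ j : Fin m, ∑ i : Fin 3, C (a j i) * X i) - ∏ j : Fin m, ∑ i : Fin 3, C (b j i) * X i : Poly3).IsHomogeneous m :=
    (prodLin_isHomogeneous m a).sub (prodLin_isHomogeneous m b)
  have hev : aeval w ((∏ j : Fin m, ∑ i : Fin 3, C (a j i) * X i) - ∏ j : Fin m, ∑ i : Fin 3, C (b j i) * X i : Poly3)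
      = ∏ j, f j - ∏ j, g j := by
    rw [map_sub, map_prod, map_prod]
    simp_rw [aeval_linForm, ← ha, ← hb]
  rw [← hev]
  exact hc m t _ w hP hw

/-! ### Rank 3 — R4: degenerate branches, the count, `RankThreeLinearLaw`, `TwoProductsLinRankThree` -/

/-- a constant has no edge direction -/
theorem not_isEdgeDir_C (ν : Fin 2 → ℝ) (c : ℂ) : ¬ IsEdgeDir ν (C c : Poly2) := by
  rintro ⟨p, hp, q, hq, hpq, -, -⟩
  have hp0 : p = 0 := by
    by_contra h; exact (mem_support_iff.mp hp) (by rw [coeff_C, if_neg (fun e => h e.symm)])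
  have hq0 : q = 0 := by
    by_contra h; exact (mem_support_iff.mp hq) (by rw [coeff_C, if_neg (fun e => h e.symm)])
  exact hpq (hp0.trans hq0.symm)

/-- constant generators ⇒ constant composite -/
theorem aeval_C3 (c : Fin 3 → ℂ) (Q : Poly3) : ∃ a : ℂ, aeval (fun i => (C (c i) : Poly2)) Q = C a := by
  induction Q using MvPolynomial.induction_on with
  | C a => exact ⟨a, by simp⟩
  | add p q hp hq =>
    obtain ⟨a, ha⟩ := hp; obtain ⟨b, hb⟩ := hq
    exact ⟨a + b, by rw [map_add, ha, hb, C_add]⟩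
  | mul_X p i hp =>
    obtain ⟨a, ha⟩ := hp
    exact ⟨a * c i, by rw [map_mul, ha, aeval_X, C_mul]⟩

/-- RANK ONE: if rows 1, 2 vanish, a homogeneous `Q` of degree `m` composes to `c · (w' 0)^m` -/
theorem aeval_rank1 {w' : Fin 3 → Poly2} (h1 : w' 1 = 0) (h2 : w' 2 = 0) {Q : Poly3} {m : ℕ}
    (hQ : Q.IsHomogeneous m) : aeval w' Q = C (coeff (Finsupp.single 0 m) Q) * (w' 0) ^ m := by
  classical
  conv_lhs => rw [Q.as_sum, map_sum]
  rw [Finset.sum_eq_single (Finsupp.single 0 m)]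
  · rw [aeval_monomial, MvPolynomial.algebraMap_eq, Finsupp.prod_single_index (h := fun i k => w' i ^ k) (pow_zero _)]
  · intro d hd hne
    rw [aeval_monomial]
    have hd12 : d 1 ≠ 0 ∨ d 2 ≠ 0 := by
      by_contra hh; push Not at hh
      apply hne
      have hwt : Finsupp.weight (1 : Fin 3 → ℕ) d = m := hQ (mem_support_iff.mp hd)
      rw [Finsupp.weight_apply, Finsupp.sum_fintype _ _ (by simp)] at hwt
      simp only [Fin.sum_univ_three, Pi.one_apply, smul_eq_mul, mul_one, hh.1, hh.2, add_zero] at hwt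
      ext i
      fin_cases i
      · simpa using hwt
      · simpa using hh.1
      · simpa using hh.2
    rcases hd12 with h | h
    · rw [Finsupp.prod, Finset.prod_eq_zero (Finsupp.mem_support_iff.mpr h)
        (by show w' 1 ^ d 1 = 0; rw [h1]; exact zero_pow h), mul_zero]
    · rw [Finsupp.prod, Finset.prod_eq_zero (Finsupp.mem_support_iff.mpr h)
        (by show w' 2 ^ d 2 = 0; rw [h2]; exact zero_pow h), mul_zero]
  · intro hnot
    rw [MvPolynomial.notMem_support_iff.mp hnot, map_zero, map_zero]

/-- `c · u^j` has no edge in a direction where `u` has a unique top -/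
theorem not_isEdgeDir_C_mul_pow {ν : Fin 2 → ℝ} {u : Poly2} {p : Expo} (hu : IsUniqueTop ν u p) (c : ℂ) :
    ∀ j : ℕ, ¬ IsEdgeDir ν (C c * u ^ j) := by
  have hu0 : u ≠ 0 := by
    intro h; have := hu.1; rw [h] at this; simp at this
  intro j
  induction j with
  | zero => rw [pow_zero, mul_one]; exact not_isEdgeDir_C ν c
  | succ j ih =>
    intro hE
    by_cases hc : c = 0
    · rw [hc, C_0, zero_mul] at hE; exact ne_zero_of_isEdgeDir hE rfl
    have hne : C c * u ^ j ≠ 0 := mul_ne_zero (by rwa [Ne, C_eq_zero]) (pow_ne_zero j hu0)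
    rw [pow_succ, ← mul_assoc] at hE
    rcases (ostrowski ν _ _ hne hu0).mp hE with h | h
    · exact ih h
    · exact not_tie_of_utop hu h

/-- `|Eset σ (Ω w')| ≤ 729 t⁶` when the rows `w'` are carried by `S3 w` (`|S3 w| ≤ 3t`). -/
theorem card_Eset_omega_le (σ : ℝ) {w : Fin 3 → Poly2} (w' : Fin 3 → Poly2) {t : ℕ}
    (hw : ∀ i, (w i).support.card ≤ t) (hsub : ∀ i, (w' i).support ⊆ S3 w) :
    (Eset σ (omega w')).card ≤ 729 * t ^ 6 := by
  have hSt : ∀ i, (w' i).support.card ≤ 3 * t := fun i => (Finset.card_le_card (hsub i)).trans (card_S3_le hw)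
  have hs := card_support_omega_le w' (3 * t) hSt
  calc (Eset σ (omega w')).card ≤ (omega w').support.card * (omega w').support.card := card_Eset_le σ (omega w')
    _ ≤ (3 * t) ^ 3 * (3 * t) ^ 3 := Nat.mul_le_mul hs hs
    _ = 729 * t ^ 6 := by ring

/-- ON ONE CHART-ARC: `|Ef_b(P(w))| ≤ (m+1)·(2 + 729 t⁶)` — the echelon lemma, the tower, and the two degenerate
branches (rows 1, 2 both zero = rank one; all generators zero). -/
theorem arc_bound3 {σ : ℝ} (hσ : σ = 1 ∨ σ = -1) (w : Fin 3 → Poly2) {t : ℕ} (hw : ∀ i, (w i).support.card ≤ t)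
    (P : Poly3) {m : ℕ} (hP : P.IsHomogeneous m) (b : ℕ) :
    (Ef σ w b (aeval w P)).card ≤ (m + 1) * (2 + 729 * t ^ 6) := by
  by_cases hE : Ef σ w b (aeval w P) = ∅
  · rw [hE]; simp
  obtain ⟨μ₀, hμ₀⟩ := Finset.nonempty_of_ne_empty hE
  obtain ⟨hedge0, harc0⟩ := (mem_Ef hσ).mp hμ₀
  have hne : (S3 w).Nonempty := by
    by_contra hS
    have hw0 : ∀ i, w i = C 0 := by
      intro i
      have hsub := support_subset_S3 w i
      rw [Finset.not_nonempty_iff_eq_empty.mp hS, Finset.subset_empty, support_eq_empty] at hsub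
      rw [hsub, C_0]
    obtain ⟨c, hc⟩ := aeval_C3 (fun _ => 0) P
    have hw' : w = fun i => (C ((fun _ : Fin 3 => (0 : ℂ)) i) : Poly2) := funext fun i => by simpa using hw0 i
    rw [hw', hc] at hedge0
    exact not_isEdgeDir_C _ c hedge0
  obtain ⟨w', P', p₀, hP', hev, hsub, h0, hn1, hn2⟩ := echelon3 hσ hne harc0.1 P hP
  have hp₀S : p₀ ∈ S3 w := hsub 0 h0.1
  have hu0 : w' 0 ≠ 0 := by
    intro h; have := h0.1; rw [h] at this; simp at this
  -- the generic finishing step, given a second row with a unique top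
  have finish : ∀ (w'' : Fin 3 → Poly2) (P'' : Poly3), P''.IsHomogeneous m → aeval w'' P'' = aeval w' P' →
      w'' 0 = w' 0 → (∀ i, (w'' i).support ⊆ S3 w) → p₀ ∉ (w'' 1).support → w'' 1 ≠ 0 →
      (Ef σ w b (aeval w' P')).card ≤ (m + 1) * (2 + 729 * t ^ 6) := by
    intro w'' P'' hP'' hev'' h0'' hsub'' hn1'' h1''
    obtain ⟨p₁, hp₁⟩ := exists_utop3 hσ harc0.1 h1'' (hsub'' 1)
    have hp₁S : p₁ ∈ S3 w := hsub'' 1 hp₁.1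
    have hne01 : p₀ ≠ p₁ := fun h => hn1'' (h ▸ hp₁.1)
    have htop : ∀ μ, OnArc σ w b μ → IsUniqueTop (dir σ μ) (w'' 0) p₀ ∧ IsUniqueTop (dir σ μ) (w'' 1) p₁ ∧
        wt (dir σ μ) p₀ ≠ wt (dir σ μ) p₁ := fun μ hμ =>
      ⟨by rw [h0'']; exact utop_onArc hσ harc0 hμ hu0 (hsub 0) h0, utop_onArc hσ harc0 hμ h1'' (hsub'' 1) hp₁,
        wt_ne3 hσ hμ.1 hp₀S hp₁S hne01⟩
    have hdeg : ∀ s ∈ P''.support, s 2 < m + 1 := fun s hs =>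
      lt_of_lt_of_le (deg2_lt_of_totalDegree P'' s hs) (Nat.add_le_add_right hP''.totalDegree_le 1)
    rw [← hev'']
    exact (tower3 hσ w b w'' hp₀S hp₁S hne01 htop (m + 1) P'' m hP'' hdeg).trans
      (Nat.mul_le_mul_left _ (Nat.add_le_add_left (card_Eset_omega_le σ w'' hw hsub'') 2))
  rw [← hev]
  by_cases h1 : w' 1 = 0
  · by_cases h2 : w' 2 = 0
    · -- rank one: no edge normal on the arc at all
      have hempty : Ef σ w b (aeval w' P') = ∅ := by
        refine Finset.eq_empty_of_forall_notMem fun μ hμ => ?_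
        obtain ⟨hedge, harc⟩ := (mem_Ef hσ).mp hμ
        rw [aeval_rank1 h1 h2 hP'] at hedge
        exact not_isEdgeDir_C_mul_pow (utop_onArc hσ harc0 harc hu0 (hsub 0) h0) _ m hedge
      rw [hempty]; simp
    · -- swap rows 1 and 2
      refine finish ![w' 0, w' 2, w' 1] (rename (Equiv.swap 1 2) P') hP'.rename_isHomogeneous ?_ rfl ?_ hn2 h2
      · rw [aeval_rename]
        have hfun : ((![w' 0, w' 2, w' 1] : Fin 3 → Poly2) ∘ ⇑(Equiv.swap (1 : Fin 3) 2)) = w' := by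
          funext i
          fin_cases i
          · simp [Equiv.swap_apply_of_ne_of_ne]
          · simp [Equiv.swap_apply_left]
          · simp [Equiv.swap_apply_right]
        rw [hfun]
      · intro i
        fin_cases i
        · exact hsub 0
        · exact hsub 2
        · exact hsub 1
  · exact finish w' P' hP' rfl rfl hsub hn1 h1

/-- PER CHART: `|Eset σ (P(w))| ≤ 9t² + (9t² + 1)(m+1)(2 + 729 t⁶)` -/
theorem Eset_bound3 {σ : ℝ} (hσ : σ = 1 ∨ σ = -1) (w : Fin 3 → Poly2) {t : ℕ} (hw : ∀ i, (w i).support.card ≤ t)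
    (P : Poly3) {m : ℕ} (hP : P.IsHomogeneous m) :
    (Eset σ (aeval w P)).card ≤ 9 * t ^ 2 + (9 * t ^ 2 + 1) * ((m + 1) * (2 + 729 * t ^ 6)) := by
  set D := aeval w P with hD
  set K := (m + 1) * (2 + 729 * t ^ 6) with hK
  have hsplit : Eset σ D ⊆ X3 σ w ∪ (Finset.range ((X3 σ w).card + 1)).biUnion (fun b => Ef σ w b D) := by
    intro μ hμ
    by_cases hX : μ ∈ X3 σ w
    · exact Finset.mem_union_left _ hX
    · apply Finset.mem_union_right
      rw [Finset.mem_biUnion]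
      exact ⟨idx3 σ w μ, Finset.mem_range.mpr (Nat.lt_succ_of_le (idx3_le σ w μ)),
        Finset.mem_filter.mpr ⟨hμ, hX, rfl⟩⟩
  have hX := card_X3_le σ hw
  calc (Eset σ D).card
      ≤ (X3 σ w ∪ (Finset.range ((X3 σ w).card + 1)).biUnion (fun b => Ef σ w b D)).card :=
        Finset.card_le_card hsplit
    _ ≤ (X3 σ w).card + ((Finset.range ((X3 σ w).card + 1)).biUnion (fun b => Ef σ w b D)).card :=
        Finset.card_union_le _ _
    _ ≤ (X3 σ w).card + ∑ b ∈ Finset.range ((X3 σ w).card + 1), (Ef σ w b D).card :=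
        Nat.add_le_add_left Finset.card_biUnion_le _
    _ ≤ (X3 σ w).card + ∑ _b ∈ Finset.range ((X3 σ w).card + 1), K :=
        Nat.add_le_add_left (Finset.sum_le_sum fun b _ => arc_bound3 hσ w hw P hP b) _
    _ = (X3 σ w).card + ((X3 σ w).card + 1) * K := by
        rw [Finset.sum_const, Finset.card_range, smul_eq_mul]
    _ ≤ 9 * t ^ 2 + (9 * t ^ 2 + 1) * K :=
        Nat.add_le_add hX (Nat.mul_le_mul_right _ (Nat.add_le_add_right hX 1))

/-- THE CRUDE RANK-THREE VERTEX BOUND (kernel): for `t`-sparse generators `w₀, w₁, w₂` and ANY homogeneous `P` of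
degree `m`, `nv(P(w)) ≤ 2·(9t² + (9t²+1)(m+1)(729t⁶+2)) + 4`. -/
theorem rankThree_nv_bound (w : Fin 3 → Poly2) {t : ℕ} (hw : ∀ i, (w i).support.card ≤ t) (P : Poly3) {m : ℕ}
    (hP : P.IsHomogeneous m) :
    nv (aeval w P) ≤ 2 * (9 * t ^ 2 + (9 * t ^ 2 + 1) * ((m + 1) * (2 + 729 * t ^ 6))) + 4 := by
  have h1 := Eset_bound3 (σ := 1) (Or.inl rfl) w hw P hP
  have h2 := Eset_bound3 (σ := -1) (Or.inr rfl) w hw P hP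
  have hn := nv_le (aeval w P)
  omega

/-- the crude arithmetic: `2·(9t² + (9t²+1)(m+1)(2+729t⁶)) + 4 ≤ (m+2)²²(t+2)²²`. -/
theorem k3_arith (m t : ℕ) :
    2 * (9 * t ^ 2 + (9 * t ^ 2 + 1) * ((m + 1) * (2 + 729 * t ^ 6))) + 4 ≤ (m + 2) ^ 22 * (t + 2) ^ 22 := by
  set Z := 13122 * t ^ 8 + 1458 * t ^ 6 + 54 * t ^ 2 + 8 with hZ
  have hL : 2 * (9 * t ^ 2 + (9 * t ^ 2 + 1) * ((m + 1) * (2 + 729 * t ^ 6))) + 4 ≤ (m + 2) * Z := by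
    calc 2 * (9 * t ^ 2 + (9 * t ^ 2 + 1) * ((m + 1) * (2 + 729 * t ^ 6))) + 4
        ≤ (2 * (9 * t ^ 2 + (9 * t ^ 2 + 1) * ((m + 1) * (2 + 729 * t ^ 6))) + 4)
            + ((13122 * t ^ 8 + 1458 * t ^ 6 + 36 * t ^ 2 + 4) + (m + 1) * (18 * t ^ 2 + 4)) := Nat.le_add_right _ _
      _ = (m + 2) * Z := by rw [hZ]; ring
  have hZ8 : Z ≤ 14642 * (t + 2) ^ 8 := by
    have a1 : t ^ 8 ≤ (t + 2) ^ 8 := Nat.pow_le_pow_left (by omega) 8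
    have a2 : t ^ 6 ≤ (t + 2) ^ 8 :=
      (Nat.pow_le_pow_left (by omega : t ≤ t + 2) 6).trans (Nat.pow_le_pow_right (by omega) (by omega))
    have a3 : t ^ 2 ≤ (t + 2) ^ 8 :=
      (Nat.pow_le_pow_left (by omega : t ≤ t + 2) 2).trans (Nat.pow_le_pow_right (by omega) (by omega))
    have a4 : 1 ≤ (t + 2) ^ 8 := Nat.one_le_pow _ _ (by omega)
    rw [hZ]; linarith
  have h14 : 14642 ≤ (t + 2) ^ 14 :=
    calc 14642 ≤ 2 ^ 14 := by norm_num
      _ ≤ (t + 2) ^ 14 := Nat.pow_le_pow_left (by omega) 14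
  calc 2 * (9 * t ^ 2 + (9 * t ^ 2 + 1) * ((m + 1) * (2 + 729 * t ^ 6))) + 4 ≤ (m + 2) * Z := hL
    _ ≤ (m + 2) * (14642 * (t + 2) ^ 8) := Nat.mul_le_mul_left _ hZ8
    _ ≤ (m + 2) ^ 22 * ((t + 2) ^ 14 * (t + 2) ^ 8) :=
        Nat.mul_le_mul (Nat.le_self_pow (by norm_num) _) (Nat.mul_le_mul_right _ h14)
    _ = (m + 2) ^ 22 * (t + 2) ^ 22 := by ring

/-- **`PortPlan3.1` IN KERNEL, crude form ⇒ `RankThreeLinearLaw` holds with `c = 22`** (the memo's arc count gives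
`t³ + 9t²(4m+1)` = `RankThreeExplicitBound`, which stays PAPER; the exponent here is bookkeeping, not mathematics). -/
theorem rankThreeLinearLaw : RankThreeLinearLaw :=
  ⟨22, fun m t P w hP hw => (rankThree_nv_bound w hw P hP).trans (k3_arith m t)⟩

/-- **THE CLASS THEOREM IN KERNEL (rung 3-LIN of the K13 side ladder):** `∏ f − ∏ g` with all `2m` factors in the
LINEAR span of three `t`-sparse bivariate polynomials has `≤ (m+2)²² (t+2)²²` Newton-polygon vertices.
Nothing here closes 5906 / `PlanarCellBound`; VP ≠ VNP is NOT proved. -/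
theorem twoProductsLinRankThree : TwoProductsLinRankThree :=
  twoProductsLinRankThree_of_law rankThreeLinearLaw

end Summit.ValiantsHypothesis.ValiantsHypothesis.Theorems.TwoProducts.RankTwoJacobian

end
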